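import Summits.ValiantsHypothesis.ValiantsHypothesis.Theorems.KPlusLogSqLawTropicalBTightBracketing

/-!
# Route «KPlusLogSqLaw», crux `TropicalB` (stmt-ValiantsHypothesis-19771) — tight-entry laws, part 2: the `m = 3` LEX SKIP LAW
# «a double step bracketing a tight entry leaves its fixed column strictly below the moved one, or jumps over a class value»

HONEST FRAMING.  Helper toward the registered stubs `stub_tropThin` / `stub_tropFat` of `Cruxes/TropicalB/Lines/birth.lean` (crux
`Summit.ValiantsHypothesis.ValiantsHypothesis.Theses.KPlusLogSqLaw.TropicalB`, item `stmt-ValiantsHypothesis-19771`, route `KPlusLogSqLaw`;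
cell `pub-symmetroid`, seat val-sym-trop-p3 g16, 2026-08-29; `--supports … --as helper`).  A STRUCTURAL fact about dominant chains of
`3 × 3` dominance designs (the `m = 3` row «fixed small `m`, all `K`» of this seat's docket, record `10K − 42 ≤ T_D(3,K) ≤ ⌊(27K−17)/2⌋`),
in the sector of DOUBLING-SEPARATED exponents (`d l < d l' → 2·d l < d l'`; e.g. every rail `d l = r^l` with `r ≥ 3`, such as the
rail `4^l` of the realised `(3, K)` families of record).  Nothing here bears on `TropicalB` in its window, `WeakLifting`, the doors,
`MatrixDescartes` (stmt-ValiantsHypothesis-18050) or VP ≠ VNP, and no counting consequence is formalised.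

THE LAW (`lex_skip_of_bracket`, on top of part 1's `offMass_bracket`).  Let `(i, k)` be a tight pair of `σ` at column `b` entering the
class `c₀`, and let `i' < k'` be positions of another permutation `σ' ≠ σ` through the same cell whose class there moves to `c₀`, whose
class at a second column `c` moves from `y⁻` to `y`, and whose class at the third column `f` stays `z` (a DOUBLE step of `σ'` on `{b, c}`).
Part 1 gives `d y⁻ + d z < d α + d β < d y + d z` for the classes `α, β` of `σ`'s term at `i` on the columns `c, f`.  With doubling-separated
exponents this pins `max(d α, d β) = d z` unless `d z < d y`, and then the other one lies strictly between `d y⁻` and `d y`: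

* either `d z < d y` — after the step the fixed column sits STRICTLY BELOW the moved column `c`;
* or `σ`'s bracketed term carries, at `c` or at `f`, a class of exponent strictly between `d y⁻` and `d y` — the double step of `σ'` JUMPED
  over a class value at column `c` (in a chain where every column advances one class at a time this case is void).
* `jump_of_bracket_starved` — hence, if the moved column `c` starts strictly below the fixed column `f` («starved»), the double step jumps
  over a class at `c` in every case.

READING (docstring only; seat memo M3-ROW-LAWMAX-g16.md §2): this is the mechanism that forces, in the idealised regime «one parity class
all-tight with unit advances», the other parity class into triple steps (12 terms per class level, the located law-maximum of period-one
schedules under the pairwise exchange laws), against the half-thin ceiling 13.5.  [this cell]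
-/

-- `Summit.ValiantsHypothesis.ValiantsHypothesis.…` repeats a component by the D-0017 layout
-- (single-conjunct summit), which the `dupNamespace` linter flags; the name is mandated.
set_option linter.dupNamespace false
set_option autoImplicit false

namespace Summit.ValiantsHypothesis.ValiantsHypothesis.Theorems.KPlusLogSqLaw

open Summit.ValiantsHypothesis.ValiantsHypothesis.Theorems.MatrixDescartes.Negative
open Summit.ValiantsHypothesis.ValiantsHypothesis.Theorems.LacunarySymmetroidMatrixDescartes.TropicalCensus
open Finset

namespace RefreshExclusivity

/-! ## 1. Arithmetic of doubling-separated exponent values -/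

/-- **Strictly between, doubling-separated form.**  If the values are doubling-separated (`d l < d l' → 2·d l < d l'`), and `d yl + d z < d α + d β < d y + d z` with
`d y ≤ d z`, then one of `d α, d β` equals `d z` and the other lies strictly between `d yl` and `d y`. [this cell] -/
theorem between_of_sep {K : ℕ} (d : Fin K → ℕ) (hsep : ∀ l l' : Fin K, d l < d l' → 2 * d l < d l')
    {yl y z α β : Fin K} (hlo : d yl + d z < d α + d β) (hhi : d α + d β < d y + d z) (hzy : d y ≤ d z) :
    (d α = d z ∧ d yl < d β ∧ d β < d y) ∨ (d β = d z ∧ d yl < d α ∧ d α < d y) := by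
  -- the larger of `d α, d β` is exactly `d z`
  rcases le_total (d β) (d α) with hba | hab
  · -- `d α` is the max
    have h1 : ¬ d z < d α := fun h => by have := hsep z α h; omega
    have h2 : ¬ d α < d z := fun h => by have := hsep α z h; omega
    have h3 : d α = d z := by omega
    left
    refine ⟨h3, by omega, by omega⟩
  · have h1 : ¬ d z < d β := fun h => by have := hsep z β h; omega
    have h2 : ¬ d β < d z := fun h => by have := hsep β z h; omega
    have h3 : d β = d z := by omega
    right
    refine ⟨h3, by omega, by omega⟩

/-- Off one column of `Fin 3`, the exponent mass is the sum over the two other columns. [folklore] -/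
theorem sum_erase_fin_three (g : Fin 3 → ℤ) {b c f : Fin 3} (hbc : b ≠ c) (hbf : b ≠ f) (hcf : c ≠ f) :
    ∑ x ∈ univ.erase b, g x = g c + g f := by
  rw [Finset.sum_erase_eq_sub (Finset.mem_univ b), Fin.sum_univ_three]
  fin_cases b <;> fin_cases c <;> fin_cases f <;> simp_all <;> ring

/-! ## 2. The `m = 3` lex skip law -/

section Chain

variable {K n : ℕ} (d : Fin K → ℕ) (v ε : Fin 3 → Fin 3 → Fin K → ℤ) (θ : Fin (n + 1) → ℤ)
  (p : Fin (n + 1) → Equiv.Perm (Fin 3) × (Fin 3 → Fin K))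

/-- **THE `m = 3` LEX SKIP LAW.**  Doubling-separated exponents; `(i, k)` a tight pair of `σ = (p k).1` at column `b`; `i' < k'` two
positions of `σ' ≠ σ` through the same cell, entering the same class at `b`, moving column `c` and fixing column `f` (`b, c, f` pairwise
distinct).  Then either the fixed column ends strictly below the moved one (`d ((p k').2 f) < d ((p k').2 c)`), or `σ`'s term at `i`
carries at `c` or at `f` a class of exponent strictly between the old and the new class of `σ'` at `c`. [this cell] -/
theorem lex_skip_of_bracket (hsep : ∀ l l' : Fin K, d l < d l' → 2 * d l < d l')
    (hθ : StrictMono θ) (hdom : ∀ k, IsDominant d v ε (θ k) (p k))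
    {i k i' k' : Fin (n + 1)} {b c f : Fin 3} (hbc : b ≠ c) (hbf : b ≠ f) (hcf : c ≠ f)
    (hik : i < k) (hpi : (p i).1 = (p k).1)
    (hoff : ∀ b', b' ≠ b → (p i).2 b' = (p k).2 b') (hchg : (p i).2 b ≠ (p k).2 b)
    (hik' : i' < k') (hpi' : (p i').1 = (p k').1) (hchg' : (p i').2 b ≠ (p k').2 b)
    (hσ : (p k').1 ≠ (p k).1) (hcell : (p k').1 b = (p k).1 b) (hcls : (p k').2 b = (p k).2 b)
    (hfix : (p i').2 f = (p k').2 f) :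
    d ((p k').2 f) < d ((p k').2 c) ∨
      ∃ x : Fin 3, x ≠ b ∧ d ((p i').2 c) < d ((p i).2 x) ∧ d ((p i).2 x) < d ((p k').2 c) := by
  obtain ⟨h1, -, h3⟩ := offMass_bracket d v ε θ p hθ hdom b hik hpi hoff hchg hik' hpi' hchg' hσ hcell hcls
  have h13 : ∑ x ∈ univ.erase b, (d ((p i).2 x) : ℤ) < ∑ x ∈ univ.erase b, (d ((p k').2 x) : ℤ) := by
    have h2 : ∑ x ∈ univ.erase b, (d ((p i).2 x) : ℤ) = ∑ x ∈ univ.erase b, (d ((p k).2 x) : ℤ) :=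
      Finset.sum_congr rfl fun x hx => by rw [hoff x (Finset.ne_of_mem_erase hx)]
    rw [h2]; exact h3
  rw [sum_erase_fin_three (fun x => (d ((p i').2 x) : ℤ)) hbc hbf hcf,
    sum_erase_fin_three (fun x => (d ((p i).2 x) : ℤ)) hbc hbf hcf] at h1
  rw [sum_erase_fin_three (fun x => (d ((p i).2 x) : ℤ)) hbc hbf hcf,
    sum_erase_fin_three (fun x => (d ((p k').2 x) : ℤ)) hbc hbf hcf] at h13
  rw [hfix] at h1
  by_cases hzy : d ((p k').2 c) ≤ d ((p k').2 f)
  · right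
    have hlo : d ((p i').2 c) + d ((p k').2 f) < d ((p i).2 c) + d ((p i).2 f) := by exact_mod_cast h1
    have hhi : d ((p i).2 c) + d ((p i).2 f) < d ((p k').2 c) + d ((p k').2 f) := by exact_mod_cast h13
    rcases between_of_sep d hsep hlo hhi hzy with ⟨-, hβ1, hβ2⟩ | ⟨-, hα1, hα2⟩
    · exact ⟨f, hbf.symm, hβ1, hβ2⟩
    · exact ⟨c, hbc.symm, hα1, hα2⟩
  · left
    omega

/-- **STARVED-MOVE COROLLARY.**  In the situation of `lex_skip_of_bracket` (doubling-separated exponents; `σ'`'s double step on the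
columns `b, c` fixing `f`, bracketing a tight pair of `σ` at `b`), if the moved column `c` starts STRICTLY BELOW the fixed column `f`
(`d ((p i').2 c) < d ((p i').2 f)`), then `σ'` jumps over a class at `c`: some class has exponent strictly between the old and the new
class of `σ'` at `c` (and, by cell monotonicity, is never used by `σ'` at that cell).  So a column starved by an earlier bracketed double
step cannot be advanced one class at a time by another bracketed double step. [this cell] -/
theorem jump_of_bracket_starved (hsep : ∀ l l' : Fin K, d l < d l' → 2 * d l < d l')
    (hθ : StrictMono θ) (hdom : ∀ k, IsDominant d v ε (θ k) (p k))
    {i k i' k' : Fin (n + 1)} {b c f : Fin 3} (hbc : b ≠ c) (hbf : b ≠ f) (hcf : c ≠ f)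
    (hik : i < k) (hpi : (p i).1 = (p k).1)
    (hoff : ∀ b', b' ≠ b → (p i).2 b' = (p k).2 b') (hchg : (p i).2 b ≠ (p k).2 b)
    (hik' : i' < k') (hpi' : (p i').1 = (p k').1) (hchg' : (p i').2 b ≠ (p k').2 b)
    (hσ : (p k').1 ≠ (p k).1) (hcell : (p k').1 b = (p k).1 b) (hcls : (p k').2 b = (p k).2 b)
    (hfix : (p i').2 f = (p k').2 f) (hstarved : d ((p i').2 c) < d ((p i').2 f)) :
    ∃ l : Fin K, d ((p i').2 c) < d l ∧ d l < d ((p k').2 c) := by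
  rcases lex_skip_of_bracket d v ε θ p hsep hθ hdom hbc hbf hcf hik hpi hoff hchg hik' hpi' hchg' hσ hcell hcls hfix
    with h | ⟨x, -, hx1, hx2⟩
  · exact ⟨(p k').2 f, by rw [← hfix]; exact hstarved, h⟩
  · exact ⟨(p i).2 x, hx1, hx2⟩

end Chain

end RefreshExclusivity

end Summit.ValiantsHypothesis.ValiantsHypothesis.Theorems.KPlusLogSqLaw
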